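import Summits.AtomisticToContinuum.Crystallization.Theorems.FluxTubeKeplerFluxCellKeplerDefectPricedOfGaps

/-!
# `FluxCellKepler` (stmt-AtomisticToContinuum-15221) — SINGLE-SCALE REDUCTION of the crux
# (crux-strategist, decomposition lens): KEPLER at ONE pattern scale `R₀ ≥ 2` is enough

The KEPLER conjunct of the crux `FluxTubeKepler.FluxCellKepler` quantifies over EVERY test scale
`R` (`∀ δ R η, ∃ c, c · #bad_(R,η) ≤ Σ_i λ_i − N e(P₀)`), while every local-score method the route
intends (one-centre table, facet transfer, m-potential / envelope, registered ledger) can only see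
`(R₀, η)`-badness for `R₀` below the score's own range.  This file removes the scale quantifier
once and for all, POTENTIAL-FREE, from landed tree theorems:

* `good_of_locallyGood` — CHART GLUING for the crux's own defect predicate: for `R₀ ≥ 2` and every
  `(δ, R, η)` there are `η' > 0` and `R'` such that, in a `δ`-separated configuration, a site all of
  whose `R'`-neighbours are `(R₀, η')`-layered-good is `(R, η)`-layered-good.  Proof = the
  compactness-and-contradiction proof of `FluxCellKeplerSketchGaps.good_of_clean` with the
  hypothesis `Good ∧ LayeredNear η'` replaced by the crux predicate at scale `R₀`
  (`setLayeredNear_of_layeredGood`: an `(R₀, η)`-good site is `SetLayeredNear η` on its 2-ball as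
  soon as `R₀ ≥ 2`), then `exactNear_of_limit` + `exactLayeredRigidity_holds` (exact local-to-global
  rigidity of box templates, landed for `ReggeStarCoercivity.DefectFreeCrystallizes`).
* `card_bad_le` — COUNTING: `#bad_(R,η) ≤ (2ρ/δ + 1)³ · #bad_(R₀,η')`
  (`squeeze_card_filter_exists_near_le`).
* `SingleScaleFluxCellKepler R₀` — the crux with KEPLER asked at the single scale `R₀` (DOM and the
  sharp constant `e(P₀)` unchanged), and
  `fluxCellKepler_of_singleScale : 2 ≤ R₀ → SingleScaleFluxCellKepler R₀ → FluxCellKepler`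
  (monotonicity in the radius for `R ≤ R₀`, gluing + counting for `R > R₀`).

So every line on the crux may prove KEPLER at one scale only (e.g. `R₀ = 2`: the 2-ball carries the
first two shells and the two adjacent layers).  The converse `FluxCellKepler → SingleScaleFluxCellKepler R₀`
is trivial (`singleScale_of_fluxCellKepler`).
-/

noncomputable section

open scoped BigOperators Classical
open Filter Topology

namespace Summit.AtomisticToContinuum.Crystallization.Theorems.FluxCellKeplerSingleScale

open Summit.AtomisticToContinuum.Crystallization.Theses.PhononSlackCertificates
open Summit.AtomisticToContinuum.Crystallization.Theorems.PrestressSplitKorn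
open Summit.AtomisticToContinuum.Crystallization.Theorems.HullBridgeExact
open Summit.AtomisticToContinuum.Crystallization.Theorems.FluxCellKeplerSketchGaps
open Literature.MathematicalPhysics.StatisticalMechanics Literature.Geometry.DiscreteGeometry

local notation "E3" => EuclideanSpace ℝ (Fin 3)

/-! ## The crux's defect predicate -/

/-- The crux's defect predicate, verbatim: site `i` of `x` is `(R, η)`-LAYERED-GOOD iff its set of
relative positions is two-way `η`-matched on the `R`-ball with a member of the relaxed Barlow /
layered family (`a ∈ [47/50, 1]`, linear isometry `A`, Hägg word `s`, heights `z` with increments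
in `[39a/50, 17a/20]`). -/
def LayeredGood (R η : ℝ) {N : ℕ} (x : Fin N → E3) (i : Fin N) : Prop :=
  ∃ a : ℝ, 47 / 50 ≤ a ∧ a ≤ 1 ∧ ∃ (A : EuclideanSpace ℝ (Fin 3) →ₗᵢ[ℝ] EuclideanSpace ℝ (Fin 3)) (s : ℤ → ℤ) (z : ℤ → ℝ), IsHaggSeq s ∧ (∀ m : ℤ, 39 / 50 * a ≤ z (m + 1) - z m ∧ z (m + 1) - z m ≤ 17 / 20 * a) ∧ let S : Set (EuclideanSpace ℝ (Fin 3)) := {p | ∃ m k l : ℤ, p = A (((k : ℝ) • triangularVec₁ a) + ((l : ℝ) • triangularVec₂ a) + ((haggLabel s m : ℝ) • barlowOffset a) + (z m • layerNormal 1))}; (∀ p ∈ S, ‖p‖ ≤ R → ∃ j : Fin N, dist (x j - x i) p ≤ η) ∧ (∀ j : Fin N, ‖x j - x i‖ ≤ R → ∃ p ∈ S, dist (x j - x i) p ≤ η)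

/-- The defect predicate is monotone in the radius. [folklore] -/
theorem layeredGood_mono {R R' η : ℝ} (hR : R ≤ R') {N : ℕ} (x : Fin N → E3) (i : Fin N) :
    LayeredGood R' η x i → LayeredGood R η x i := by
  rintro ⟨a, ha₁, ha₂, A, s, z, hs, hz, h₁, h₂⟩
  refine ⟨a, ha₁, ha₂, A, s, z, hs, hz, ?_, ?_⟩
  · intro p hp hpR
    exact h₁ p hp (hpR.trans hR)
  · intro j hj
    exact h₂ j (hj.trans hR)

/-- **Adapter.** For `R₀ ≥ 2`, an `(R₀, η)`-layered-good site `j` is `SetLayeredNear η` (radius-2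
two-way matching with a rigid image of a box template, the local predicate of the landed gluing
machinery) in the configuration recentred at any site `i₀`, with translation `-(x j − x i₀)`.
[folklore] -/
theorem setLayeredNear_of_layeredGood {R₀ η : ℝ} (hR₀ : 2 ≤ R₀) {N : ℕ} {x : Fin N → E3}
    (i₀ : Fin N) {j : Fin N} (h : LayeredGood R₀ η x j) :
    SetLayeredNear η (Set.range fun k => x k - x i₀) (x j - x i₀) := by
  obtain ⟨a, ha₁, ha₂, A, s, z, hs, hz, hmatch⟩ := h
  try dsimp only at hmatch
  rw [nl_setOf_eq_range A a s z] at hmatch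
  obtain ⟨h₁, h₂⟩ := hmatch
  refine ⟨A, -(x j - x i₀), a, s, z, ⟨ha₁, ha₂, hz⟩, hs, ?_, ?_⟩
  · rintro _ ⟨k, rfl⟩ hk
    rw [dist_sub_right, dist_eq_norm] at hk
    obtain ⟨_, ⟨l, rfl⟩, hd⟩ := h₂ k (hk.trans hR₀)
    refine ⟨l, ?_⟩
    rwa [← sub_eq_add_neg, sub_sub_sub_cancel_right]
  · intro l hl
    rw [add_neg_cancel, dist_zero_right] at hl
    obtain ⟨k, hk⟩ := h₁ _ ⟨l, rfl⟩ (hl.trans hR₀)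
    refine ⟨x k - x i₀, ⟨k, rfl⟩, ?_⟩
    rwa [← sub_eq_add_neg, sub_sub_sub_cancel_right]

/-! ## (1) Chart gluing for the crux predicate -/

/-- **Chart gluing (potential-free).** For `R₀ ≥ 2`, every separation `δ > 0` and every scale
`(R, η)`, `η > 0`, there are `η' > 0` and `R'` such that in every `δ`-separated finite
configuration, a site all of whose neighbours within `R'` are `(R₀, η')`-layered-good is itself
`(R, η)`-layered-good.  Compactness and contradiction: the local limit of the recentred
configurations is exactly layered near every point (`exactNear_of_limit`), hence ONE rigid image of
ONE box template (`exactLayeredRigidity_holds`), which, re-based at the origin, matches the recentred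
configuration two ways at scale `(R, η)` for large index. [folklore] -/
theorem good_of_locallyGood {R₀ : ℝ} (hR₀ : 2 ≤ R₀) : ∀ δ : ℝ, 0 < δ → ∀ R η : ℝ, 0 < η →
    ∃ η' : ℝ, 0 < η' ∧ ∃ R' : ℝ,
    ∀ (N : ℕ) (x : Fin N → E3), (∀ i j : Fin N, i ≠ j → δ ≤ dist (x i) (x j)) →
    ∀ i : Fin N, (∀ j : Fin N, dist (x j) (x i) ≤ R' → LayeredGood R₀ η' x j) →
      LayeredGood R η x i := by
  intro δ hδ R η hη
  by_contra H
  have key : ∀ n : ℕ, ∃ (N : ℕ) (x : Fin N → E3) (i : Fin N),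
      (∀ i j : Fin N, i ≠ j → δ ≤ dist (x i) (x j)) ∧
      (∀ j : Fin N, dist (x j) (x i) ≤ n → LayeredGood R₀ (1 / ((n : ℝ) + 1)) x j) ∧
      ¬ LayeredGood R η x i := by
    intro n
    by_contra hn
    push Not at hn
    exact H ⟨1 / ((n : ℝ) + 1), by positivity, n, fun N x hsep i hi => hn N x i hsep hi⟩
  choose N x i hsep hloc hbad using key
  -- recentred particle sets and their local limit
  set Ys : ℕ → Set E3 := fun n => Set.range fun j => x n j - x n (i n) with hYs
  have hYsep : ∀ n, ∀ p ∈ Ys n, ∀ q ∈ Ys n, p ≠ q → δ ≤ dist p q := by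
    rintro n _ ⟨j, rfl⟩ _ ⟨j', rfl⟩ hne
    rw [dist_sub_right]
    exact hsep n j j' fun h => hne (by rw [h])
  obtain ⟨φ, Y, hφ, hYsep', hmatch⟩ := exists_subseq_forall_eventually_ballMatch hδ Ys hYsep
  have hφt : Tendsto φ atTop atTop := hφ.tendsto_atTop
  have hfin : ∀ w : E3, (Y ∩ Metric.closedBall w 1).Finite := fun w =>
    finite_of_forall_le_dist_of_subset_closedBall hδ (fun p hp q hq => hYsep' p hp.1 q hq.1)
      Set.inter_subset_right
  -- `0 ∈ Y`
  have h0 : (0 : E3) ∈ Y := by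
    apply mem_of_forall_exists_dist_le (hfin 0)
    intro γ hγ
    obtain ⟨k, hk⟩ := (hmatch 1 γ hγ).exists
    obtain ⟨y, hy, hd⟩ := hk.2 0 ⟨i (φ k), by simp⟩ (by simp)
    exact ⟨y, hy, by rwa [dist_comm]⟩
  -- every point of the approximants in view is layered-near (the adapter)
  have hloc' : ∀ k, ∀ q ∈ Ys (φ k), ‖q‖ ≤ (φ k : ℝ) →
      SetLayeredNear (1 / ((φ k : ℝ) + 1)) (Ys (φ k)) q := by
    rintro k _ ⟨j, rfl⟩ hj
    have := hloc (φ k) j (by rwa [dist_eq_norm])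
    exact setLayeredNear_of_layeredGood hR₀ (i (φ k)) this
  -- every point of `Y` is exactly layered
  have hexact : ∀ p ∈ Y, ExactNear Y p := fun p hp =>
    exactNear_of_limit hδ hYsep' (fun ρ γ hγ => hmatch ρ γ hγ)
      (tendsto_one_div_add_atTop_nhds_zero_nat.comp hφt)
      (tendsto_natCast_atTop_atTop.comp hφt) hloc' hp
  -- the global template, re-based at the origin
  obtain ⟨A, t, a, s, z, hbox, hs, hYeq⟩ :=
    exactLayeredRigidity_holds Y ⟨0, h0⟩ ⟨δ, hδ, hYsep'⟩ hexact
  have h0' := h0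
  rw [hYeq] at h0'
  obtain ⟨l₀, hl₀⟩ := h0'
  rw [zero_add] at hl₀
  set s' : ℤ → ℤ := fun k => s (k + l₀.1) with hs'
  set z' : ℤ → ℝ := fun k => z (k + l₀.1) - z l₀.1 with hz'
  have hbox' : InBox a z' := hbox.shift l₀.1
  have key2 : ∀ l, A (layeredPos a s' z' l) = A (layeredPos a s z (l + l₀)) - t := fun l => by
    rw [hs', hz', layeredPos_shift, map_sub, hl₀]
  have hYeq' : Y = Set.range fun l => A (layeredPos a s' z' l) := by
    ext y
    rw [hYeq]
    constructor
    · rintro ⟨l, hl⟩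
      refine ⟨l - l₀, ?_⟩
      show A (layeredPos a s' z' (l - l₀)) = y
      rw [key2, sub_add_cancel, ← hl, add_sub_cancel_right]
    · rintro ⟨l, rfl⟩
      refine ⟨l + l₀, ?_⟩
      show A (layeredPos a s' z' l) + t = A (layeredPos a s z (l + l₀))
      rw [key2, sub_add_cancel]
  -- matching at scale `(R, η)` for some index gives goodness there: contradiction
  obtain ⟨k, hk⟩ := (hmatch R η hη).exists
  refine hbad (φ k) ?_
  unfold LayeredGood
  refine ⟨a, hbox'.1, hbox'.2.1, A, s', z', isHaggSeq_shift hs _, hbox'.2.2, ?_⟩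
  dsimp only
  rw [nl_setOf_eq_range A a s' z', ← hYeq']
  refine ⟨fun p hp hpR => ?_, fun j hj => ?_⟩
  · obtain ⟨_, ⟨j, rfl⟩, hj⟩ := hk.1 p hp (by rwa [dist_zero_right])
    exact ⟨j, hj⟩
  · obtain ⟨p, hp, hd⟩ := hk.2 _ ⟨j, rfl⟩ (by rwa [dist_zero_right])
    exact ⟨p, hp, hd⟩

/-! ## (2) Counting -/

/-- **Counting form of the gluing.** For `R₀ ≥ 2`, `δ > 0` and a scale `(R, η)` there are `η' > 0`
and `M > 0` with `#bad_(R,η)(x) ≤ M · #bad_(R₀,η')(x)` on every `δ`-separated finite configuration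
(`M = (2ρ/δ + 1)³`, `ρ = max R' 0`: the sites within `ρ` of an `(R₀, η')`-bad one are at most `M`
times their number, `squeeze_card_filter_exists_near_le`, and every other site is good by
`good_of_locallyGood`). [folklore] -/
theorem card_bad_le {R₀ : ℝ} (hR₀ : 2 ≤ R₀) {δ : ℝ} (hδ : 0 < δ) (R η : ℝ) (hη : 0 < η) :
    ∃ η' : ℝ, 0 < η' ∧ ∃ M : ℝ, 0 < M ∧ ∀ (N : ℕ) (x : Fin N → E3),
      (∀ i j : Fin N, i ≠ j → δ ≤ dist (x i) (x j)) →
      (Nat.card {i : Fin N // ¬ LayeredGood R η x i} : ℝ) ≤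
        M * Nat.card {i : Fin N // ¬ LayeredGood R₀ η' x i} := by
  obtain ⟨η', hη', R', hglue⟩ := good_of_locallyGood hR₀ δ hδ R η hη
  set ρ : ℝ := max R' 0 with hρ
  refine ⟨η', hη', (2 * ρ / δ + 1) ^ 3, by positivity, fun N x hsep => ?_⟩
  set D := Finset.univ.filter fun j : Fin N => ¬ LayeredGood R₀ η' x j with hD
  set B := Finset.univ.filter fun i : Fin N => ∃ j ∈ D, dist (x j) (x i) ≤ ρ with hB
  have hBle : (B.card : ℝ) ≤ (2 * ρ / δ + 1) ^ 3 * D.card :=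
    squeeze_card_filter_exists_near_le hδ (le_max_right _ _) hsep D
  have hbadB : Nat.card {i : Fin N // ¬ LayeredGood R η x i} ≤ B.card := by
    have hle : Nat.card {i : Fin N // ¬ LayeredGood R η x i} ≤ Nat.card {i : Fin N // i ∈ B} := by
      rw [Nat.card_eq_fintype_card, Nat.card_eq_fintype_card]
      refine Fintype.card_subtype_mono _ _ fun i hi => ?_
      by_contra hiB
      refine hi (hglue N x hsep i fun j hj => ?_)
      by_contra hjD
      exact hiB (Finset.mem_filter.2 ⟨Finset.mem_univ _, j,
        Finset.mem_filter.2 ⟨Finset.mem_univ _, hjD⟩, hj.trans (le_max_left _ _)⟩)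
    rwa [Nat.card_eq_finsetCard] at hle
  have hDcard : (D.card : ℝ) = Nat.card {i : Fin N // ¬ LayeredGood R₀ η' x i} := by
    rw [Nat.card_eq_fintype_card, Fintype.card_subtype]
  calc (Nat.card {i : Fin N // ¬ LayeredGood R η x i} : ℝ) ≤ B.card := by exact_mod_cast hbadB
    _ ≤ (2 * ρ / δ + 1) ^ 3 * D.card := hBle
    _ = (2 * ρ / δ + 1) ^ 3 * Nat.card {i : Fin N // ¬ LayeredGood R₀ η' x i} := by rw [hDcard]

/-! ## (3) The single-scale crux and the reduction -/

/-- **The single-scale flux-cell Kepler inequality** `X_(R₀)`: the crux `FluxCellKepler` with its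
KEPLER conjunct asked at ONE test scale `R₀` only — there are a periodic `P₀`, a pattern radius `R₁`
and a LOCAL tail credit `τ` with (DOM) `Σ_i site₆(x)_i ≤ Σ_i τ(pattern_i)` on every finite injective
configuration (verbatim) and (KEPLER at `R₀`) for every `δ > 0` and `η > 0` some `c > 0` with
`c · #{(R₀, η)-bad sites} ≤ Σ_i ((1/24) site₁₂,i − (1/12) τ(pattern_i)) − N e(P₀)` on every
`δ`-separated finite injective configuration.  Trivially implied by the crux; implies it for
`R₀ ≥ 2` (`fluxCellKepler_of_singleScale`). [conjecture] -/
def SingleScaleFluxCellKepler (R₀ : ℝ) : Prop :=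
  ∃ (P₀ : PeriodicConfiguration 3) (R₁ : ℝ) (τ : Finset (EuclideanSpace ℝ (Fin 3)) → ℝ),
    (∀ (N : ℕ) (x : Fin N → EuclideanSpace ℝ (Fin 3)), Function.Injective x →
      ∑ i, siteEnergy (fun r => (r⁻¹) ^ 6) x i ≤
        ∑ i, τ ((Finset.univ.filter fun j : Fin N => dist (x j) (x i) ≤ R₁).image fun j => x j - x i)) ∧
    (∀ δ : ℝ, 0 < δ → ∀ η : ℝ, 0 < η → ∃ c : ℝ, 0 < c ∧
      ∀ (N : ℕ) (x : Fin N → EuclideanSpace ℝ (Fin 3)), Function.Injective x →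
        (∀ i j, i ≠ j → δ ≤ dist (x i) (x j)) →
        c * (Nat.card {i : Fin N // ¬ LayeredGood R₀ η x i} : ℝ) ≤
          ∑ i, ((1 / 24 : ℝ) * siteEnergy (fun r => (r⁻¹) ^ 12) x i -
            (1 / 12 : ℝ) * τ ((Finset.univ.filter fun j : Fin N => dist (x j) (x i) ≤ R₁).image fun j => x j - x i)) -
            (N : ℝ) * P₀.energyPerParticle lennardJones)

/-- **Single-scale reduction of the crux.** For `R₀ ≥ 2`,
`SingleScaleFluxCellKepler R₀ → FluxTubeKepler.FluxCellKepler`: DOM is unchanged; KEPLER at scale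
`R ≤ R₀` follows from KEPLER at `R₀` with the same constant (`layeredGood_mono`); at scale
`R > R₀` take `η'`, `M` from `card_bad_le` and the constant `c(δ, η')/M`. [folklore] -/
theorem fluxCellKepler_of_singleScale {R₀ : ℝ} (hR₀ : 2 ≤ R₀) (h : SingleScaleFluxCellKepler R₀) :
    Summit.AtomisticToContinuum.Crystallization.Theses.FluxTubeKepler.FluxCellKepler := by
  obtain ⟨P₀, R₁, τ, hdom, hkep⟩ := h
  refine ⟨P₀, R₁, τ, hdom, ?_⟩
  intro δ hδ R η hR hη
  by_cases hRR : R ≤ R₀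
  · obtain ⟨c, hc, hcb⟩ := hkep δ hδ η hη
    refine ⟨c, hc, fun N x hx hsep => ?_⟩
    show c * (Nat.card {i : Fin N // ¬ LayeredGood R η x i} : ℝ) ≤ _
    have hmono : (Nat.card {i : Fin N // ¬ LayeredGood R η x i} : ℝ) ≤
        Nat.card {i : Fin N // ¬ LayeredGood R₀ η x i} := by
      have hle : Nat.card {i : Fin N // ¬ LayeredGood R η x i} ≤
          Nat.card {i : Fin N // ¬ LayeredGood R₀ η x i} := by
        rw [Nat.card_eq_fintype_card, Nat.card_eq_fintype_card]
        exact Fintype.card_subtype_mono _ _ fun i hi hg => hi (layeredGood_mono hRR x i hg)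
      exact_mod_cast hle
    exact (mul_le_mul_of_nonneg_left hmono hc.le).trans (hcb N x hx hsep)
  · have hRR' : R₀ < R := not_le.mp hRR
    obtain ⟨η', hη', M, hM, hcount⟩ := card_bad_le hR₀ hδ R η hη
    obtain ⟨c, hc, hcb⟩ := hkep δ hδ η' hη'
    refine ⟨c / M, div_pos hc hM, fun N x hx hsep => ?_⟩
    show c / M * (Nat.card {i : Fin N // ¬ LayeredGood R η x i} : ℝ) ≤ _
    have h1 := hcount N x hsep
    have h2 := hcb N x hx hsep
    have h3 : c / M * (Nat.card {i : Fin N // ¬ LayeredGood R η x i} : ℝ) ≤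
        c * Nat.card {i : Fin N // ¬ LayeredGood R₀ η' x i} := by
      calc c / M * (Nat.card {i : Fin N // ¬ LayeredGood R η x i} : ℝ)
          ≤ c / M * (M * Nat.card {i : Fin N // ¬ LayeredGood R₀ η' x i}) :=
            mul_le_mul_of_nonneg_left h1 (div_pos hc hM).le
        _ = c * Nat.card {i : Fin N // ¬ LayeredGood R₀ η' x i} := by
            field_simp
    exact h3.trans h2

/-- The converse direction is trivial: the crux gives the single-scale form at every `R₀ > 0`.
[folklore] -/
theorem singleScale_of_fluxCellKepler {R₀ : ℝ} (hR₀ : 0 < R₀)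
    (h : Summit.AtomisticToContinuum.Crystallization.Theses.FluxTubeKepler.FluxCellKepler) :
    SingleScaleFluxCellKepler R₀ := by
  obtain ⟨P₀, R₁, τ, hdom, hkep⟩ := h
  exact ⟨P₀, R₁, τ, hdom, fun δ hδ η hη => hkep δ hδ R₀ η hR₀ hη⟩

/-! ## Registered helper stubs of the crux item (inline signatures over Literature declarations) -/

/-- **Registered helper `stub_chartGluing` (stmt-AtomisticToContinuum-15221)**: `good_of_locallyGood` with the
crux predicate written inline. [folklore] -/
theorem stub_chartGluing : ∀ R₀ : ℝ, 2 ≤ R₀ → ∀ δ : ℝ, 0 < δ → ∀ R η : ℝ, 0 < η → ∃ η' : ℝ, 0 < η' ∧ ∃ R' : ℝ, ∀ (N : ℕ) (x : Fin N → EuclideanSpace ℝ (Fin 3)), (∀ i j : Fin N, i ≠ j → δ ≤ dist (x i) (x j)) → ∀ i : Fin N, (∀ j : Fin N, dist (x j) (x i) ≤ R' → (∃ a : ℝ, 47 / 50 ≤ a ∧ a ≤ 1 ∧ ∃ (A : EuclideanSpace ℝ (Fin 3) →ₗᵢ[ℝ] EuclideanSpace ℝ (Fin 3)) (s : ℤ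 → ℤ) (z : ℤ → ℝ), Literature.MathematicalPhysics.StatisticalMechanics.IsHaggSeq s ∧ (∀ m : ℤ, 39 / 50 * a ≤ z (m + 1) - z m ∧ z (m + 1) - z m ≤ 17 / 20 * a) ∧ let S : Set (EuclideanSpace ℝ (Fin 3)) := {p | ∃ m k l : ℤ, p = A (((k : ℝ) • Literature.MathematicalPhysics.StatisticalMechanics.triangularVec₁ a) + ((l : ℝ) • Literature.MathematicalPhysics.StatisticalMechanics.triangularVec₂ a) + ((Literature.MathematicalPhysics.StatisticalMechanics.haggLabel s m : ℝ) • Literature.MathematicalPhysics.StatisticalMechanics.barlowOffset a) + (z m • Literature.MathematicalPhysics.StatisticalMechanics.layerNormal 1))}; (∀ p ∈ S, ‖p‖ ≤ R₀ → ∃ k : Fin N, dist (x k - x j) p ≤ η') ∧ (∀ k : Fin N, ‖x k - x j‖ ≤ R₀ → ∃ p ∈ S, dist (x k - x j) p ≤ η'))) → (∃ a : ℝ, 47 / 50 ≤ a ∧ a ≤ 1 ∧ ∃ (A : EuclideanSpace ℝ (Fin 3) →ₗᵢ[ℝ] EuclideanSpace ℝ (Fin 3)) (s : ℤ → ℤ)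 (z : ℤ → ℝ), Literature.MathematicalPhysics.StatisticalMechanics.IsHaggSeq s ∧ (∀ m : ℤ, 39 / 50 * a ≤ z (m + 1) - z m ∧ z (m + 1) - z m ≤ 17 / 20 * a) ∧ let S : Set (EuclideanSpace ℝ (Fin 3)) := {p | ∃ m k l : ℤ, p = A (((k : ℝ) • Literature.MathematicalPhysics.StatisticalMechanics.triangularVec₁ a) + ((l : ℝ) • Literature.MathematicalPhysics.StatisticalMechanics.triangularVec₂ a) + ((Literature.MathematicalPhysics.StatisticalMechanics.haggLabel s m : ℝ) • Literature.MathematicalPhysics.StatisticalMechanics.barlowOffset a) + (z m • Literature.MathematicalPhysics.StatisticalMechanics.layerNormal 1))}; (∀ p ∈ S, ‖p‖ ≤ R → ∃ j : Fin N, dist (x j - x i) p ≤ η) ∧ (∀ j : Fin N, ‖x j - x i‖ ≤ R → ∃ p ∈ S, dist (x j - x i) p ≤ η)) := by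
  intro R₀ hR₀
  exact good_of_locallyGood hR₀

/-- **Registered helper `stub_singleScaleReduction` (stmt-AtomisticToContinuum-15221)**:
`fluxCellKepler_of_singleScale` with the single-scale crux written inline — KEPLER at one pattern
scale `R₀ ≥ 2` (with DOM and the sharp constant) already gives `FluxCellKepler`. [folklore] -/
theorem stub_singleScaleReduction : ∀ R₀ : ℝ, 2 ≤ R₀ → (∃ (P₀ : Literature.MathematicalPhysics.StatisticalMechanics.PeriodicConfiguration 3) (R₁ : ℝ) (τ : Finset (EuclideanSpace ℝ (Fin 3)) → ℝ), (∀ (N : ℕ) (x : Fin N → EuclideanSpace ℝ (Fin 3)), Function.Injective x → ∑ i, Literature.MathematicalPhysics.StatisticalMechanics.siteEnergy (fun r => (r⁻¹) ^ 6) x i ≤ ∑ i, τ ((Finset.univ.filter fun j : Fin N => dist (x j) (x i) ≤ R₁).image fun j => x j - x i)) ∧ (∀ δ : ℝ, 0 < δ → ∀ η : ℝ, 0 < η → ∃ c : ℝ, 0 < c ∧ ∀ (N : ℕ) (x : Fin N → EuclideanSpace ℝ (Fin 3)), Function.Injective x → (∀ i j, i ≠ j → δ ≤ dist (x i) (x j))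 → c * (Nat.card {i : Fin N // ¬ ∃ a : ℝ, 47 / 50 ≤ a ∧ a ≤ 1 ∧ ∃ (A : EuclideanSpace ℝ (Fin 3) →ₗᵢ[ℝ] EuclideanSpace ℝ (Fin 3)) (s : ℤ → ℤ) (z : ℤ → ℝ), Literature.MathematicalPhysics.StatisticalMechanics.IsHaggSeq s ∧ (∀ m : ℤ, 39 / 50 * a ≤ z (m + 1) - z m ∧ z (m + 1) - z m ≤ 17 / 20 * a) ∧ let S : Set (EuclideanSpace ℝ (Fin 3)) := {p | ∃ m k l : ℤ, p = A (((k : ℝ) • Literature.MathematicalPhysics.StatisticalMechanics.triangularVec₁ a) + ((l : ℝ) • Literature.MathematicalPhysics.StatisticalMechanics.triangularVec₂ a) + ((Literature.MathematicalPhysics.StatisticalMechanics.haggLabel s m : ℝ) • Literature.MathematicalPhysics.StatisticalMechanics.barlowOffset a) + (z m • Literature.MathematicalPhysics.StatisticalMechanics.layerNormal 1))}; (∀ p ∈ S, ‖p‖ ≤ R₀ → ∃ j : Fin N, dist (x j - x i) p ≤ η) ∧ (∀ j : Fin N, ‖x j - x i‖ ≤ R₀ → ∃ p ∈ S, dist (x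 j - x i) p ≤ η)} : ℝ) ≤ ∑ i, ((1 / 24 : ℝ) * Literature.MathematicalPhysics.StatisticalMechanics.siteEnergy (fun r => (r⁻¹) ^ 12) x i - (1 / 12 : ℝ) * τ ((Finset.univ.filter fun j : Fin N => dist (x j) (x i) ≤ R₁).image fun j => x j - x i)) - (N : ℝ) * P₀.energyPerParticle Literature.MathematicalPhysics.StatisticalMechanics.lennardJones)) → Summit.AtomisticToContinuum.Crystallization.Theses.FluxTubeKepler.FluxCellKepler := by
  intro R₀ hR₀ h
  exact fluxCellKepler_of_singleScale hR₀ h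

end Summit.AtomisticToContinuum.Crystallization.Theorems.FluxCellKeplerSingleScale

end
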